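import Summits.ResolutionOfSingularities.ResolutionOfSingularities.Theses.IndSmooth
import Literature.FieldTheory.Separability.FormallySmoothAlgebraic

/-!
# `IndSmooth.ValuativeSmoothing`: the hypothesis `PerfectField k` is load-bearing
# (negative-side support for crux `stmt-ResolutionOfSingularities-16087`, refuter vetting seat)

Crux `Summit.ResolutionOfSingularities.ResolutionOfSingularities.Theses.IndSmooth.ValuativeSmoothing`
(ind-smoothness of valuation rings of function fields over PERFECT fields of characteristic `p`):
for `k` perfect of characteristic `p`, `K/k` finitely generated, `O` a valuation ring of `K` containing
`k` and `R ⊆ O` a finitely generated `k`-subalgebra, the inclusion `R ↪ O` factors `R → T → O` through a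
smooth `k`-algebra `T`.

`valuativeSmoothing_false_without_perfectField` negates the SAME statement with the single instance
hypothesis `[PerfectField k]` DELETED (written inline, verbatim otherwise; nothing but theorems is
declared under `Summits/`).  It is FALSE, sorry-free, by the degenerate specimen of transcendence
degree `0`:

* `p = 2`, `k = 𝔽₂(t)` (`RatFunc (ZMod 2)`, imperfect), `K = k(t^{1/2}) = k[X]/(X² - t)`
  (`AdjoinRoot`, a field since `t` is not a square in `k`: `intDegree` parity), `O = K` (the trivial
  valuation ring — the only one, `K/k` being algebraic), `R = K` (finitely generated: `[K : k] = 2`).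
* A factorisation `K → T → K` of the identity through a smooth `k`-algebra `T` makes `K` a RETRACT of a
  formally smooth `k`-algebra, hence formally smooth over `k` (`formallySmooth_of_retract`, the
  infinitesimal lifting property composed with the retraction); a formally smooth ALGEBRAIC field
  extension is separable (Matsumura, Commutative Ring Theory, Thm. 26.9 — tree:
  `Literature.FieldTheory.Separability.Algebra.IsSeparable.of_formallySmooth_of_isAlgebraic`), whereas
  the minimal polynomial `X² - t` of `t^{1/2}` has zero derivative in characteristic `2`.

Moral for provers of the crux: any proof must use perfectness of `k` already in transcendence degree
`0` / for the trivial valuation; over an imperfect ground field the correct "smooth" target is a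
REGULAR (not smooth) `k`-algebra, cf. the sibling crux `DescentPerfectToAll` (stmt-0549) and the
barrier `Literature.Barriers.ResolutionOfSingularities.RegularNotGeometricallyRegular`.
-/

set_option linter.dupNamespace false -- mandated namespace of this single-conjunct summit

namespace Summit.ResolutionOfSingularities.ResolutionOfSingularities.Theorems.ValuativeSmoothing.Negative

open Polynomial

universe u

/-- A retract of a formally smooth algebra is formally smooth: if `σ : A → T`, `χ : T → A` are
`R`-algebra maps with `χ ∘ σ = id` and `T` is formally smooth over `R`, so is `A` (lift `g ∘ χ`, then
precompose with `σ`). [folklore] -/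
theorem formallySmooth_of_retract {R : Type u} {A T : Type u} [CommRing R] [CommRing A] [Algebra R A]
    [CommRing T] [Algebra R T] [Algebra.FormallySmooth R T] (σ : A →ₐ[R] T) (χ : T →ₐ[R] A)
    (h : ∀ a, χ (σ a) = a) : Algebra.FormallySmooth R A := by
  refine Algebra.FormallySmooth.of_comp_surjective fun B _ _ I hI g => ?_
  obtain ⟨l, hl⟩ := Algebra.FormallySmooth.comp_surjective R T I hI (g.comp χ)
  refine ⟨l.comp σ, ?_⟩
  ext a
  have := AlgHom.congr_fun hl (σ a)
  simp only [AlgHom.comp_apply] at this ⊢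
  rw [this, h]

/-- The hypothesis `k ⊆ O` (`∀ c, algebraMap k K c ∈ O`) of the crux is implied by the others: any
`k`-subalgebra `R` with `R ≤ O` contains the image of `k`.  (Vetting remark: the hypothesis is
redundant, not harmful.) [folklore] -/
theorem algebraMap_mem_of_subalgebra_le {k K : Type u} [Field k] [Field K] [Algebra k K]
    (O : ValuationSubring K) (R : Subalgebra k K) (hRO : R.toSubring ≤ O.toSubring) (c : k) :
    algebraMap k K c ∈ O :=
  hRO (R.algebraMap_mem c)

/-- `t = X` is not a square in `𝔽₂(t)` (degree parity). [folklore] -/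
theorem X_not_square : ∀ b : RatFunc (ZMod 2), b ^ 2 ≠ (RatFunc.X : RatFunc (ZMod 2)) := by
  intro b hb
  have hb0 : b ≠ 0 := by
    rintro rfl
    exact RatFunc.X_ne_zero (by simpa using hb.symm)
  have h1 := congrArg RatFunc.intDegree hb
  rw [pow_two, RatFunc.intDegree_mul hb0 hb0, RatFunc.intDegree_X] at h1
  omega

/-- The Kummer polynomial `X² - t ∈ 𝔽₂(t)[X]` is irreducible. [folklore] -/
theorem irreducible_kummer :
    Irreducible (X ^ 2 - C (RatFunc.X : RatFunc (ZMod 2)) : (RatFunc (ZMod 2))[X]) :=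
  X_pow_sub_C_irreducible_of_prime Nat.prime_two X_not_square

/-- **`PerfectField k` is load-bearing in `IndSmooth.ValuativeSmoothing`**: the crux with the
instance hypothesis `[PerfectField k]` deleted (verbatim otherwise) is false — witness `p = 2`,
`k = 𝔽₂(t)`, `K = k(√t)`, `O = K`, `R = K`: a smooth factorisation of `id_K` would make the purely
inseparable extension `K/k` formally smooth, hence separable (Matsumura Thm. 26.9). [folklore] -/
theorem valuativeSmoothing_false_without_perfectField :
    ¬ (∀ p : ℕ, p.Prime → ∀ (k K : Type) [Field k] [CharP k p] [Field K] [Algebra k K],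
        (⊤ : IntermediateField k K).FG → ∀ O : ValuationSubring K, (∀ c : k, algebraMap k K c ∈ O) →
        ∀ R : Subalgebra k K, R.FG → R.toSubring ≤ O.toSubring →
        ∃ (T : Type) (_ : CommRing T) (_ : Algebra k T), Algebra.Smooth k T ∧
          ∃ (ψ : R →ₐ[k] T) (χ : T →ₐ[k] K), (∀ t : T, χ t ∈ O) ∧ ∀ r : R, χ (ψ r) = (r : K)) := by
  intro H
  -- the specimen
  set f : (RatFunc (ZMod 2))[X] := X ^ 2 - C (RatFunc.X : RatFunc (ZMod 2)) with hf
  haveI hirr : Fact (Irreducible f) := ⟨irreducible_kummer⟩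
  have hmonic : f.Monic := monic_X_pow_sub_C _ two_ne_zero
  have hf0 : f ≠ 0 := hmonic.ne_zero
  have hnat : f.natDegree = 2 := by rw [hf, natDegree_X_pow_sub_C]
  -- `K = k[X]/(f)` is a field, finite of degree 2 over `k`
  haveI : Module.Finite (RatFunc (ZMod 2)) (AdjoinRoot f) := (AdjoinRoot.powerBasis hf0).finite
  have hK : (⊤ : IntermediateField (RatFunc (ZMod 2)) (AdjoinRoot f)).FG :=
    IntermediateField.fg_of_noetherian ⊤
  have hR : (⊤ : Subalgebra (RatFunc (ZMod 2)) (AdjoinRoot f)).FG := Subalgebra.fg_of_noetherian ⊤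
  obtain ⟨T, _, _, hT, ψ, χ, -, hψχ⟩ :=
    H 2 Nat.prime_two (RatFunc (ZMod 2)) (AdjoinRoot f) hK ⊤ (fun _ => trivial) ⊤ hR (fun _ _ => trivial)
  -- `K` is a retract of the smooth `T`, hence formally smooth over `k`
  haveI : Algebra.FormallySmooth (RatFunc (ZMod 2)) T := hT.formallySmooth
  let σ : AdjoinRoot f →ₐ[RatFunc (ZMod 2)] T := ψ.comp (Subalgebra.topEquiv).symm.toAlgHom
  have hσ : ∀ a, χ (σ a) = a := fun a => hψχ ⟨a, Algebra.mem_top⟩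
  haveI : Algebra.FormallySmooth (RatFunc (ZMod 2)) (AdjoinRoot f) := formallySmooth_of_retract σ χ hσ
  -- hence separable (Matsumura 26.9, algebraic case)
  haveI : Algebra.IsSeparable (RatFunc (ZMod 2)) (AdjoinRoot f) :=
    Literature.FieldTheory.Separability.Algebra.IsSeparable.of_formallySmooth_of_isAlgebraic
      (RatFunc (ZMod 2)) (AdjoinRoot f)
  -- but the minimal polynomial `f` of `√t` is inseparable in characteristic 2
  have hsep : (minpoly (RatFunc (ZMod 2)) (AdjoinRoot.root f)).Separable :=
    Algebra.IsSeparable.isSeparable (RatFunc (ZMod 2)) (AdjoinRoot.root f)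
  have hmin : minpoly (RatFunc (ZMod 2)) (AdjoinRoot.root f) = f := by
    rw [AdjoinRoot.minpoly_root hf0, hmonic.leadingCoeff, inv_one, C_1, mul_one]
  rw [hmin] at hsep
  have hder : derivative f = 0 := by
    rw [hf, derivative_sub, derivative_X_pow, derivative_C, sub_zero]
    have h2 : ((2 : ℕ) : RatFunc (ZMod 2)) = 0 := by
      have := CharTwo.two_eq_zero (R := RatFunc (ZMod 2))
      exact_mod_cast this
    rw [h2, C_0, zero_mul]
  rw [Polynomial.separable_def, hder, isCoprime_zero_right, hmonic.isUnit_iff] at hsep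
  have := congrArg natDegree hsep
  rw [hnat, natDegree_one] at this
  exact absurd this (by norm_num)

end Summit.ResolutionOfSingularities.ResolutionOfSingularities.Theorems.ValuativeSmoothing.Negative
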